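import Summits.Ventures.HSemireg.WedgePointPairPowersKernelSpan

/-!
# Venture HSemireg — the kernel of `θ ↦ θ ∧ F` on the `(1,1)`-PLANE of `⋀²` (one `X`-letter, one `Y`-letter) for the `n`-fold box of
# `m`-dimensional point pairs: the SPLIT PAIRS and nothing else (every `m ≥ 2`, `n`) — C4 / C5's «first-order locus» count `n·m²`

HONEST FRAMING. Part of the Lean index of the computation cell `pub-hsemireg` (seat p10 gen 7, Sunday typer «UNIFORM-IN-n»).
Finite-dimensional EXTERIOR ALGEBRA over a field ONLY: no variety, no cohomology theory, no sheaf, no Ext group, no Hodge locus and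
no semiregularity map is constructed here; nothing here says that HC / HC_CM / HC_AV holds; no Literature fact is declared or used.
Custodian versions cited: STRUCTURE.md v1.0-SIGNED 9b196a05977dd067 §1.1 C4 («ker ⌟ch … = H¹(T_X) ⊗ 1 ⊕ 1 ⊗ H¹(T_X′)», `2n²`) and C5
(«first-order Hodge loci 2n² / n²»: the split number `2n²`); theory/FORMULA-N.md PART A §4.2–§4.3, §5.1 (th-6).

Model as in `WedgePointPairPowers*.lean`: generators `Fin ((m+m)·n)` in `n` blocks `X_i ⊔ Y_i`, box `F = Π_i (a·E_{X_i} + c·E_{Y_i})`.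
In the QUOTED dictionary (`X`-letters ↔ `H⁰(T)`-type, `Y`-letters ↔ `H¹(𝒪)`-type directions; NOT asserted) the degree-2 monomials
with ONE `X`-letter and ONE `Y`-letter span the `H¹(T_Y) = H⁰(T) ⊗ H¹(𝒪)`-type PLANE of `HT²(Y)` — the first-order deformations of
the complex structure — and the kernel of `⌟ch` there is the first-order locus where the class stays of type `(p,p)`.
* §1 the `(1,1)`-SETS `ooSet` (`{x, y}`, `x ∈ XX`, `y ∉ XX`; `(mn)²` of them, `card_ooSet`), the `(1,1)`-PLANE `ooPlane = span{E_s}`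
  (`finrank_ooPlane = (mn)²`), the restricted map `phiOO : θ ↦ θ ∧ F` on it; gen 6's split pairs are `(1,1)`-sets;
* §2 (`m ≥ 2`) an ALIVE `(1,1)`-set (its two letters in different blocks) is its own canonical source family (`ooSrc`, every block
  part has at most one letter), so the images `E_s ∧ F` of the alive `(1,1)`-sets are NON-ZERO MULTIPLES OF DISTINCT CLASS VECTORS,
  hence linearly independent (`linearIndependent_ooAlive`, th-7's disjoint-support criterion);
* §3 MAIN THEOREM **`map_ker_phiOO_eq_span_splitPairs`**: for every field, `m ≥ 2`, `n`, `a, c ≠ 0`, the kernel of `θ ↦ θ ∧ F` on the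
  `(1,1)`-plane IS the span of the `n·m²` SPLIT PAIRS `x ∧ y` (`x ∈ X_i`, `y ∈ Y_i`, same block; gen 6's `splitPairs`): a kernel
  vector's coordinates on the alive `(1,1)`-sets vanish by §2, and the killed `(1,1)`-sets are the split pairs
  (`killedSet_two_eq_splitPairs`); **`finrank_ker_phiOO = n·m²`**, **`finrank_range_phiOO`: rank on the plane `= (mn)² − n·m²`**.
  Quoted reading: the first-order locus of the box class inside `H¹(T_Y)` is `⊕_i H¹(T_{X_i})` — the PRODUCT deformations — of
  dimension `Σ m² = n·m²`; two factors of dimension `n`: C4 / C5's `2n²`.  For `m ≥ 3` this is already gen 6's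
  `map_ker_wedge_pairBox_two_eq_span_splitPairs` (the whole degree-2 kernel is split); the content here is `m = 2` (surfaces), where the
  degree-2 kernel has `n` more COLLAPSED lines `E_{Y_i} − λE_{X_i}` (p10 g7's `WedgePointPairPowersKernelCollapse`), none of which lies
  in the `(1,1)`-plane.  NOT here: `m = 1` (curves: the `(1,1)`-sets `{x_i, y_j}`, `{y_i, x_j}` collapse onto the same class and
  the kernel on the plane grows to `n(n+1)/2`), the Ext side, any non-split statement (C5's `n²` is NOT a box statement).
Namespace `Summit.Ventures.HSemireg.Wedge.PairPowers`; new names only.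
-/

open Module Set Set.powersetCard Polynomial

namespace Summit.Ventures.HSemireg.Wedge.PairPowers

open Summit.Ventures.HSemireg.Wedge Summit.Ventures.HSemireg.Wedge.Kunneth

variable (K : Type*) [Field K] {m n : ℕ}

/-! ## §1. The `(1,1)`-sets and the `(1,1)`-plane -/

variable (m n) in
/-- the `(1,1)`-SETS: two-element sets with one `X`-letter and one `Y`-letter (any blocks). -/
def ooSet : Finset (Finset (Fin ((m + m) * n))) := (XX m n ×ˢ (XX m n)ᶜ).image fun p => {p.1, p.2}

/-- an `X`-letter and a non-`X`-letter are distinct. -/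
lemma ne_of_mem_XX_of_not_mem {x y : Fin ((m + m) * n)} (hx : x ∈ XX m n) (hy : y ∉ XX m n) : x ≠ y :=
  fun h => hy (h ▸ hx)

/-- membership in `ooSet`. -/
lemma mem_ooSet {s : Finset (Fin ((m + m) * n))} : s ∈ ooSet m n ↔ ∃ x ∈ XX m n, ∃ y ∉ XX m n, s = {x, y} := by
  rw [ooSet, Finset.mem_image]
  constructor
  · rintro ⟨⟨x, y⟩, hxy, rfl⟩
    rw [Finset.mem_product, Finset.mem_compl] at hxy
    exact ⟨x, hxy.1, y, hxy.2, rfl⟩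
  · rintro ⟨x, hx, y, hy, rfl⟩
    exact ⟨(x, y), Finset.mem_product.mpr ⟨hx, Finset.mem_compl.mpr hy⟩, rfl⟩

/-- a `(1,1)`-set has two letters. -/
lemma card_of_mem_ooSet {s : Finset (Fin ((m + m) * n))} (hs : s ∈ ooSet m n) : s.card = 2 := by
  obtain ⟨x, hx, y, hy, rfl⟩ := mem_ooSet.mp hs
  exact Finset.card_pair (ne_of_mem_XX_of_not_mem hx hy)

/-- the `X`-letter of a `(1,1)`-set determines the pair: `{x, y} ↦ (x, y)` is injective on `XX × XXᶜ`. -/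
lemma pair_injOn : Set.InjOn (fun p : Fin ((m + m) * n) × Fin ((m + m) * n) => ({p.1, p.2} : Finset (Fin ((m + m) * n))))
    ↑(XX m n ×ˢ (XX m n)ᶜ) := by
  rintro ⟨x, y⟩ hxy ⟨x', y'⟩ hxy' h
  rw [Finset.mem_coe, Finset.mem_product, Finset.mem_compl] at hxy hxy'
  simp only at h
  have hx' : x ∈ ({x', y'} : Finset _) := h ▸ Finset.mem_insert_self x {y}
  have hxx : x = x' := by
    rcases Finset.mem_insert.mp hx' with h1 | h1
    · exact h1
    · rw [Finset.mem_singleton] at h1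
      exact absurd (h1 ▸ hxy.1) hxy'.2
  have hy' : y ∈ ({x', y'} : Finset _) := h ▸ Finset.mem_insert_of_mem (Finset.mem_singleton_self y)
  have hyy : y = y' := by
    rcases Finset.mem_insert.mp hy' with h1 | h1
    · exact absurd (h1 ▸ hxy'.1) hxy.2
    · rwa [Finset.mem_singleton] at h1
  rw [hxx, hyy]

/-- **there are `(mn)²` `(1,1)`-sets** (`mn` `X`-letters, `mn` other letters). -/
theorem card_ooSet : (ooSet m n).card = (m * n) * (m * n) := by
  rw [ooSet, Finset.card_image_of_injOn pair_injOn, Finset.card_product, Finset.card_compl, Fintype.card_fin, card_XX]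
  congr 1
  rw [Nat.sub_eq_iff_eq_add (by nlinarith)]
  ring

/-- the lift of an `X`-letter of block `i` is an `X`-letter; of a `Y`-letter, not. -/
lemma blockEmb_mem_XX_iff (i : Fin n) (j : Fin (m + m)) : blockEmb m n i j ∈ XX m n ↔ j ∈ Xs m := by
  rw [mem_XX, blockEmb_val, Nat.mul_add_mod, Nat.mod_eq_of_lt j.2, WedgePair.mem_Xset]

/-- **gen 6's split pairs are `(1,1)`-sets**. -/
theorem splitPairs_subset_ooSet : splitPairs m n ⊆ ooSet m n := by
  intro s hs
  rw [splitPairs, Finset.mem_biUnion] at hs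
  obtain ⟨i, -, hs⟩ := hs
  obtain ⟨⟨x, y⟩, hxy, rfl⟩ := Finset.mem_image.mp hs
  obtain ⟨hx, hy⟩ := Finset.mem_product.mp hxy
  obtain ⟨jx, hjx, rfl⟩ := mem_lift.mp hx
  obtain ⟨jy, hjy, rfl⟩ := mem_lift.mp hy
  refine mem_ooSet.mpr ⟨_, (blockEmb_mem_XX_iff i jx).mpr hjx, _, fun h => ?_, rfl⟩
  exact Finset.disjoint_left.mp (WedgePair.disjoint_XY m) ((blockEmb_mem_XX_iff i jy).mp h) hjy

variable (m n) in
/-- the `(1,1)`-PLANE of `⋀²`: the span of the `(1,1)`-monomials `E_{{x,y}}`. -/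
noncomputable def ooPlane : Submodule K (HT K (Fin ((m + m) * n))) :=
  Submodule.span K (Set.range fun s : ooSet m n => B K (Fin ((m + m) * n)) s.1)

/-- **the `(1,1)`-plane has dimension `(mn)²`**. -/
theorem finrank_ooPlane : finrank K (ooPlane K m n) = (m * n) * (m * n) := by
  rw [ooPlane, finrank_span_eq_card, Fintype.card_coe, card_ooSet]
  exact (B K (Fin ((m + m) * n))).linearIndependent.comp (fun s : ooSet m n => s.1) Subtype.val_injective

/-- `θ ↦ θ ∧ F` restricted to the `(1,1)`-plane. -/
noncomputable def phiOO (a c : K) : ooPlane K m n →ₗ[K] HT K (Fin ((m + m) * n)) :=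
  LinearMap.mulRight K (pairBox K (m := m) (n := n) a c) ∘ₗ (ooPlane K m n).subtype

/-- the restricted map on a vector of the plane. -/
lemma phiOO_apply (a c : K) (v : ooPlane K m n) : phiOO K a c v = (v : HT K (Fin ((m + m) * n))) * pairBox K (m := m) (n := n) a c :=
  rfl

/-! ## §2. `m ≥ 2`: alive `(1,1)`-sets are their own canonical source families -/

variable (m n) in
/-- the ALIVE `(1,1)`-sets (the two letters lie in different blocks). -/
def ooAlive : Finset (Finset (Fin ((m + m) * n))) :=
  (ooSet m n).filter fun s => ∀ i : Fin n, Disjoint (pb m n i s) (Ys m) ∨ Disjoint (pb m n i s) (Xs m)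

/-- membership in `ooAlive`. -/
lemma mem_ooAlive {s : Finset (Fin ((m + m) * n))} :
    s ∈ ooAlive m n ↔ s ∈ ooSet m n ∧ ∀ i : Fin n, Disjoint (pb m n i s) (Ys m) ∨ Disjoint (pb m n i s) (Xs m) :=
  Finset.mem_filter

/-- **every block part of an alive `(1,1)`-set has at most one letter**: two letters in one block would be an `X`- and a `Y`-letter
of that block, i.e. a (killed) split pair. -/
lemma card_pb_le_one_of_mem_ooAlive {s : Finset (Fin ((m + m) * n))} (hs : s ∈ ooAlive m n) (i : Fin n) : (pb m n i s).card ≤ 1 := by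
  obtain ⟨hoo, hal⟩ := mem_ooAlive.mp hs
  obtain ⟨x, hx, y, hy, rfl⟩ := mem_ooSet.mp hoo
  by_contra hlt
  -- both letters lie in block `i`
  have h2 : (pb m n i {x, y}).card = ({x, y} : Finset _).card :=
    le_antisymm (card_pb_le _ i) (by rw [Finset.card_pair (ne_of_mem_XX_of_not_mem hx hy)]; omega)
  have hsub : ({x, y} : Finset _) ⊆ D m n i := by
    have h3 : ({x, y} : Finset _) ∩ D m n i = {x, y} :=
      Finset.eq_of_subset_of_card_le Finset.inter_subset_left (by rw [← lift_pb, card_lift, h2])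
    exact h3 ▸ Finset.inter_subset_right
  have hxD := hsub (Finset.mem_insert_self x {y})
  have hyD := hsub (Finset.mem_insert_of_mem (Finset.mem_singleton_self y))
  rw [D, Finset.mem_map] at hxD hyD
  obtain ⟨jx, -, rfl⟩ := hxD
  obtain ⟨jy, -, rfl⟩ := hyD
  have hjx : jx ∈ Xs m := (blockEmb_mem_XX_iff i jx).mp hx
  have hjy : jy ∈ Ys m := by
    have h := (blockEmb_mem_XX_iff i jy).not.mp hy
    rw [WedgePair.mem_Xset, not_lt] at h
    rw [WedgePair.mem_Yset]
    exact h
  rcases hal i with hY | hX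
  · exact Finset.disjoint_left.mp hY (mem_pb.mpr (Finset.mem_insert_of_mem (Finset.mem_singleton_self _))) hjy
  · exact Finset.disjoint_left.mp hX (mem_pb.mpr (Finset.mem_insert_self _ _)) hjx

/-- the canonical source family of an alive `(1,1)`-set (`m ≥ 2`): block `i ↦` its block part (at most one letter `< m`). -/
def ooSrc (hm : 2 ≤ m) (s : ooAlive m n) : Fin n → Opt m := fun i =>
  ⟨pb m n i s.1, mem_optSet_of_alive ((mem_ooAlive.mp s.2).2 i) (lt_of_le_of_lt (card_pb_le_one_of_mem_ooAlive s.2 i) hm)⟩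

/-- its source is the set itself. -/
lemma src_ooSrc (hm : 2 ≤ m) (s : ooAlive m n) : src (ooSrc hm s) = s.1 := biUnion_lift_pb s.1

/-- so distinct alive `(1,1)`-sets have distinct source families. -/
lemma ooSrc_injective (hm : 2 ≤ m) : Function.Injective (ooSrc (m := m) (n := n) hm) := fun s s' h =>
  Subtype.ext (by rw [← src_ooSrc hm s, ← src_ooSrc hm s', h])

/-- **the image of an alive `(1,1)`-set is a non-zero multiple of its own class vector** (`m ≥ 2`, `a, c ≠ 0`). -/
lemma B_mul_pairBox_eq_smul_vec (hm : 2 ≤ m) {a c : K} (ha : a ≠ 0) (hc : c ≠ 0) (s : ooAlive m n) :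
    ∃ μ : K, μ ≠ 0 ∧ B K (Fin ((m + m) * n)) s.1 * pairBox K (m := m) (n := n) a c = μ • vec K a c (ooSrc hm s) := by
  obtain ⟨μ, hμ, e⟩ := B_mul_pairBox K (by omega) ha hc s.1
  refine ⟨μ, hμ, ?_⟩
  rw [e, vec, src_ooSrc]

/-- **the images `E_s ∧ F` of the alive `(1,1)`-sets are linearly independent** (`m ≥ 2`; distinct classes have disjoint supports). -/
theorem linearIndependent_ooAlive (hm : 2 ≤ m) {a c : K} (ha : a ≠ 0) (hc : c ≠ 0) :
    LinearIndependent K (fun s : ooAlive m n => B K (Fin ((m + m) * n)) s.1 * pairBox K (m := m) (n := n) a c) := by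
  have hm1 : 1 ≤ m := by omega
  apply SurfacePowers.linearIndependent_of_disjoint_support
  · intro s
    obtain ⟨μ, hμ, e⟩ := B_mul_pairBox_eq_smul_vec K hm ha hc s
    rw [e]
    exact smul_ne_zero hμ (vec_ne_zero K hm1 ha hc _)
  · intro s s' hne T
    obtain ⟨μ, -, e⟩ := B_mul_pairBox_eq_smul_vec K hm ha hc s
    obtain ⟨μ', -, e'⟩ := B_mul_pairBox_eq_smul_vec K hm ha hc s'
    rw [e, e', map_smul, map_smul, smul_eq_mul, smul_eq_mul]
    rcases coord_vec_eq_zero_or K hm1 ha hc (fun h => hne (ooSrc_injective hm h)) T with h0 | h0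
    · exact Or.inl (by rw [h0, mul_zero])
    · exact Or.inr (by rw [h0, mul_zero])

/-! ## §3. The kernel on the `(1,1)`-plane is the span of the split pairs (`m ≥ 2`) -/

/-- a `(1,1)`-set that is not alive is a split pair (gen 6: the killed 2-sets are the split pairs). -/
lemma mem_splitPairs_of_not_alive {s : Finset (Fin ((m + m) * n))} (hs : s ∈ ooSet m n)
    (h : ¬ ∀ i : Fin n, Disjoint (pb m n i s) (Ys m) ∨ Disjoint (pb m n i s) (Xs m)) : s ∈ splitPairs m n := by
  rw [← killedSet_two_eq_splitPairs, mem_killedSet]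
  exact ⟨card_of_mem_ooSet hs, h⟩

/-- a split pair is killed. -/
lemma not_alive_of_mem_splitPairs {s : Finset (Fin ((m + m) * n))} (hs : s ∈ splitPairs m n) :
    ¬ ∀ i : Fin n, Disjoint (pb m n i s) (Ys m) ∨ Disjoint (pb m n i s) (Xs m) := by
  rw [← killedSet_two_eq_splitPairs, mem_killedSet] at hs
  exact hs.2

/-- **MAIN THEOREM, every field, `m ≥ 2`, `n`, `a, c ≠ 0**: the kernel of `θ ↦ θ ∧ F` on the `(1,1)`-plane of `⋀² K^{(m+m)n}` is the
span of the `n·m²` SPLIT PAIRS `E_{{x,y}}`, `x ∈ X_i`, `y ∈ Y_i` (gen 6's `splitPairs`; as a subspace of `⋀ K^{(m+m)n}`). -/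
theorem map_ker_phiOO_eq_span_splitPairs (hm : 2 ≤ m) {a c : K} (ha : a ≠ 0) (hc : c ≠ 0) :
    (LinearMap.ker (phiOO K (m := m) (n := n) a c)).map (ooPlane K m n).subtype =
      Submodule.span K (Set.range fun s : splitPairs m n => B K (Fin ((m + m) * n)) s.1) := by
  have hm1 : 1 ≤ m := by omega
  apply le_antisymm
  · rintro _ ⟨v, hv, rfl⟩
    rw [SetLike.mem_coe, LinearMap.mem_ker, phiOO_apply] at hv
    -- coordinates of `v`: supported on the `(1,1)`-sets
    set cv := (B K (Fin ((m + m) * n))).repr (v : HT K (Fin ((m + m) * n))) with hcv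
    have hw : (v : HT K (Fin ((m + m) * n))) ∈
        Submodule.span K ((fun s => B K (Fin ((m + m) * n)) s) '' (ooSet m n : Set (Finset (Fin ((m + m) * n))))) := by
      rw [Set.image_eq_range]
      exact v.2
    have hsupp : ↑cv.support ⊆ (ooSet m n : Set (Finset (Fin ((m + m) * n)))) := (B K _).mem_span_image.mp hw
    have hexp : (v : HT K (Fin ((m + m) * n))) = ∑ s ∈ ooSet m n, cv s • B K (Fin ((m + m) * n)) s := by
      rw [← Finsupp.linearCombination_apply_of_mem_supported K ((Finsupp.mem_supported K cv).mpr hsupp), hcv,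
        Basis.linearCombination_repr]
    -- multiply by `F`: only the alive `(1,1)`-sets survive
    have hsum : ∑ s ∈ ooAlive m n, cv s • (B K (Fin ((m + m) * n)) s * pairBox K (m := m) (n := n) a c) = 0 := by
      calc ∑ s ∈ ooAlive m n, cv s • (B K (Fin ((m + m) * n)) s * pairBox K (m := m) (n := n) a c)
          = ∑ s ∈ ooSet m n, cv s • (B K (Fin ((m + m) * n)) s * pairBox K (m := m) (n := n) a c) := by
            rw [ooAlive, Finset.sum_filter]
            refine Finset.sum_congr rfl fun s _ => ?_
            split_ifs with h
            · rfl
            · rw [B_mul_pairBox_eq_zero_of_not_alive K hm1 ha hc h, smul_zero]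
        _ = (v : HT K (Fin ((m + m) * n))) * pairBox K (m := m) (n := n) a c := by
            rw [hexp, Finset.sum_mul]
            exact Finset.sum_congr rfl fun s _ => (smul_mul_assoc _ _ _).symm
        _ = 0 := hv
    -- independence (§2) kills the alive coordinates
    have hzero : ∀ s ∈ ooAlive m n, cv s = 0 := by
      have h := Fintype.linearIndependent_iff.mp (linearIndependent_ooAlive K hm ha hc) (fun s => cv s.1)
        (by rw [← Finset.sum_coe_sort] at hsum; exact hsum)
      exact fun s hs => h ⟨s, hs⟩
    -- what is left is a combination of split pairs
    show (v : HT K (Fin ((m + m) * n))) ∈ _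
    rw [hexp]
    refine Submodule.sum_mem _ fun s hs => ?_
    by_cases h : ∀ i : Fin n, Disjoint (pb m n i s) (Ys m) ∨ Disjoint (pb m n i s) (Xs m)
    · rw [hzero s (mem_ooAlive.mpr ⟨hs, h⟩), zero_smul]
      exact Submodule.zero_mem _
    · exact Submodule.smul_mem _ _ (Submodule.subset_span ⟨⟨s, mem_splitPairs_of_not_alive hs h⟩, rfl⟩)
  · rw [Submodule.span_le]
    rintro _ ⟨⟨s, hs⟩, rfl⟩
    refine ⟨⟨B K (Fin ((m + m) * n)) s, Submodule.subset_span ⟨⟨s, splitPairs_subset_ooSet hs⟩, rfl⟩⟩, ?_, rfl⟩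
    rw [SetLike.mem_coe, LinearMap.mem_ker, phiOO_apply]
    exact B_mul_pairBox_eq_zero_of_not_alive K hm1 ha hc (not_alive_of_mem_splitPairs hs)

/-- **`dim ker(θ ↦ θ ∧ F ∣ (1,1)-plane) = n·m²`** for every field, `m ≥ 2`, `n`, `a, c ≠ 0` — in the quoted dictionary the PRODUCT
deformations `⊕_i H¹(T_{X_i})` (`Σ_i m² = n·m²`; two factors of dimension `n`: STRUCTURE C4 / C5's `2n²`). -/
theorem finrank_ker_phiOO (hm : 2 ≤ m) {a c : K} (ha : a ≠ 0) (hc : c ≠ 0) :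
    finrank K (LinearMap.ker (phiOO K (m := m) (n := n) a c)) = n * (m * m) := by
  rw [← Submodule.finrank_map_subtype_eq, map_ker_phiOO_eq_span_splitPairs K hm ha hc, finrank_span_eq_card, Fintype.card_coe,
    card_splitPairs]
  exact (B K (Fin ((m + m) * n))).linearIndependent.comp (fun s : splitPairs m n => s.1) Subtype.val_injective

/-- **rank on the `(1,1)`-plane: `(mn)² − n·m²`** (`m ≥ 2`): every alive `(1,1)`-monomial survives with an independent image. -/
theorem finrank_range_phiOO (hm : 2 ≤ m) {a c : K} (ha : a ≠ 0) (hc : c ≠ 0) :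
    finrank K (LinearMap.range (phiOO K (m := m) (n := n) a c)) = (m * n) * (m * n) - n * (m * m) := by
  have h := LinearMap.finrank_range_add_finrank_ker (phiOO K (m := m) (n := n) a c)
  rw [finrank_ooPlane, finrank_ker_phiOO K hm ha hc] at h
  omega

/-- two factors of dimension `n` (`n ≥ 2`): the kernel on the `(1,1)`-plane has dimension `2n²` — C4 / C5's split number. -/
theorem finrank_ker_phiOO_two_factors (hn : 2 ≤ n) {a c : K} (ha : a ≠ 0) (hc : c ≠ 0) :
    finrank K (LinearMap.ker (phiOO K (m := n) (n := 2) a c)) = 2 * n ^ 2 := by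
  rw [finrank_ker_phiOO K hn ha hc]
  ring

/-- surfaces (`m = 2`): `4n` on the plane, although the whole degree-2 kernel has `5n` dimensions (the `n` collapsed lines
`E_{Y_i} − λE_{X_i}` of `WedgePointPairPowersKernelCollapse` lie off the `(1,1)`-plane). -/
theorem finrank_ker_phiOO_surface {a c : K} (ha : a ≠ 0) (hc : c ≠ 0) :
    finrank K (LinearMap.ker (phiOO K (m := 2) (n := n) a c)) = 4 * n := by
  rw [finrank_ker_phiOO K le_rfl ha hc]
  ring

end Summit.Ventures.HSemireg.Wedge.PairPowers
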